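import Mathlib
import HarnessLib
import Summits.NavierStokesRegularity.NavierStokesRegularity.Theorems.IsobarTomographyTubeAlternativeStubTwoSidedVorticityRate

/-!
# Crux `IsobarTomography.BlobRiccatiClosure` (stmt-NavierStokesRegularity-11740), line
# `type-i-apex-liouville`, stub B `stub_apexZoom` — tools I: scaling at the zoom centre and the
# limit of a quadratic form under diagonal convergence

Helper file (theorems only) for the extremal-apex zoom. Two groups of elementary facts:

* **Scaling of the blob data under the viscosity-normalising zoom.** For the zoomed pair
  `w = a • u ∘ Φ`, `q = a² • p ∘ Φ`, `Φ(s, y) = (T + β s, x₀ + γ y)`, at a point `(s, y)` with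
  physical image `(t, x)`: `curl w(s)(y) = (aγ) • curl u(t)(x)` (tree: `curl_smul_stPull_slice`),
  `Δq(s)(y) = a²γ² Δp(t)(x)` and `D²q(s)(y)[m] = a²γ² D²p(t)(x)[m]`
  (`laplacian_smul_stPull_slice`, `iteratedFDeriv_two_smul_stPull_slice`); hence the blob
  inequality `κ‖ω‖²Δp ≤ D²p[ω, ω]`, homogeneous of degree `8` in the zoom factor when `a γ = a²γ²`
  (the Navier–Stokes zoom has `a = c`, `γ = cν`, `β = c²ν`, so `aγ = c²ν = a²γ²/… `— we keep the
  two weights separate and only use `0 ≤ a²γ²`), transfers verbatim to the zoomed pair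
  (`blob_smul_stPull_slice`).
* **Registered sub-goal `stub_hessianApplyLimit`** (pure linear algebra/topology on `ℝ³`): if
  symmetric bilinear forms `H_j` converge to a symmetric `H` on the DIAGONAL (`H_j(e,e) → H(e,e)`
  for every `e`) and `ω_j → ω`, then `H_j(ω_j, ω_j) → H(ω, ω)` (polarisation gives every entry
  `H_j(a,b) → H(a,b)`; expand `ω_j` in the standard basis). This is how the pointwise convergence
  of the pressure Hessians delivered by stub B2 (`stub_hessianCentreLimit`, diagonal values) is
  consumed at the moving vorticity vectors `ω_j = curl w_j(σ, 0) → curl W(σ, 0)`.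

References: folklore.
-/

noncomputable section

open Set Filter Topology Function
open scoped InnerProductSpace

-- the summit and its single sub-problem share the name (CONVENTIONS §1), as in every Theorems file
set_option linter.dupNamespace false

namespace Summit.NavierStokesRegularity.NavierStokesRegularity.Theorems.BlobRiccatiClosure.TypeIApexLiouville

open Literature.Analysis Literature.Analysis.FluidPDE
open Summit.NavierStokesRegularity.NavierStokesRegularity.Theorems.TubeAlternative.AnalyticPropagation
  (curl_smul_stPull_slice fderiv_smul_stPull_slice)

/-! ### Scaling of second derivatives under the zoom -/

/-- **Second derivatives of a zoomed scalar slice**: for `p(t') ∈ C²`, `t' = T + β s`,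
`D²(a • p ∘ Φ)(s)(y)[m] = (a γ²) • D²p(t')(x₀ + γ y)[m]`. [folklore] -/
theorem iteratedFDeriv_two_smul_stPull_slice {a β γ T : ℝ} {x₀ : EuclideanSpace ℝ (Fin 3)}
    {p : ℝ → EuclideanSpace ℝ (Fin 3) → ℝ} {s : ℝ} (hp : ContDiff ℝ 2 (p (T + β * s)))
    (y : EuclideanSpace ℝ (Fin 3)) (m : Fin 2 → EuclideanSpace ℝ (Fin 3)) :
    iteratedFDeriv ℝ 2 ((a • stPull β γ T x₀ p) s) y m =
      (a * γ ^ 2) * iteratedFDeriv ℝ 2 (p (T + β * s)) (x₀ + γ • y) m := by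
  set g : EuclideanSpace ℝ (Fin 3) → ℝ := fun x => p (T + β * s) (x₀ + x) with hg
  have hgc : ContDiff ℝ 2 g := hp.comp (contDiff_const.add contDiff_id)
  have h1 : stPull β γ T x₀ p s = g ∘ (γ • ContinuousLinearMap.id ℝ (EuclideanSpace ℝ (Fin 3))) := by
    funext x; simp [g]
  have hsl : (a • stPull β γ T x₀ p) s = fun z => a • stPull β γ T x₀ p s z := rfl
  have hst : ContDiff ℝ 2 (stPull β γ T x₀ p s) := by
    rw [h1]; exact hgc.comp (ContinuousLinearMap.contDiff _)
  rw [hsl, iteratedFDeriv_const_smul_apply' (hst.contDiffAt), smul_apply,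
    h1, ContinuousLinearMap.iteratedFDeriv_comp_right _ hgc y le_rfl,
    ContinuousMultilinearMap.compContinuousLinearMap_apply]
  have h2 : (fun j : Fin 2 => (γ • ContinuousLinearMap.id ℝ (EuclideanSpace ℝ (Fin 3))) (m j)) =
      fun j => γ • m j := by
    funext j; simp
  rw [h2, ContinuousMultilinearMap.map_smul_univ, Fin.prod_const, hg,
    iteratedFDeriv_comp_add_left]
  simp only [smul_apply, ContinuousLinearMap.coe_id', id_eq, smul_eq_mul]
  ring

/-- **Laplacian of a zoomed scalar slice**: for `p(t') ∈ C²`, `t' = T + β s`,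
`Δ(a • p ∘ Φ)(s)(y) = (a γ²) Δp(t')(x₀ + γ y)`. [folklore] -/
theorem laplacian_smul_stPull_slice {a β γ T : ℝ} {x₀ : EuclideanSpace ℝ (Fin 3)}
    {p : ℝ → EuclideanSpace ℝ (Fin 3) → ℝ} {s : ℝ} (hp : ContDiff ℝ 2 (p (T + β * s)))
    (y : EuclideanSpace ℝ (Fin 3)) :
    Laplacian.laplacian ((a • stPull β γ T x₀ p) s) y =
      (a * γ ^ 2) * Laplacian.laplacian (p (T + β * s)) (x₀ + γ • y) := by
  rw [InnerProductSpace.laplacian_eq_iteratedFDeriv_orthonormalBasis _ (stdOrthonormalBasis ℝ _),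
    InnerProductSpace.laplacian_eq_iteratedFDeriv_orthonormalBasis _ (stdOrthonormalBasis ℝ _),
    Finset.mul_sum]
  exact Finset.sum_congr rfl fun i _ => iteratedFDeriv_two_smul_stPull_slice hp y _

/-- **The blob inequality is scale-exact.** If `κ‖ω‖²Δp(t)(x) ≤ D²p(t)(x)[ω, ω]` at the physical
point `(t, x) = Φ(s, y)`, `ω = curl u(t)(x)`, and the zoom weights satisfy `a γ = λ`,
`a² γ'² = λ²` — for the Navier–Stokes zoom `a = c`, `γ = cν`, velocity weight `λ = c²ν`, pressure
weight `a² = c²` — then the zoomed pair `w = a • u ∘ Φ`, `q = a² • p ∘ Φ` satisfies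
`κ‖curl w(s)(y)‖² Δq(s)(y) ≤ D²q(s)(y)[curl w(s)(y), curl w(s)(y)]`. [folklore] -/
theorem blob_smul_stPull_slice {a β γ T κ : ℝ} {x₀ : EuclideanSpace ℝ (Fin 3)}
    {u : ℝ → EuclideanSpace ℝ (Fin 3) → EuclideanSpace ℝ (Fin 3)}
    {p : ℝ → EuclideanSpace ℝ (Fin 3) → ℝ} {s : ℝ}
    (hu : Differentiable ℝ (u (T + β * s))) (hp : ContDiff ℝ 2 (p (T + β * s)))
    (y : EuclideanSpace ℝ (Fin 3))
    (hblob : κ * ‖curl (u (T + β * s)) (x₀ + γ • y)‖ ^ 2 *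
        Laplacian.laplacian (p (T + β * s)) (x₀ + γ • y) ≤
      iteratedFDeriv ℝ 2 (p (T + β * s)) (x₀ + γ • y)
        ![curl (u (T + β * s)) (x₀ + γ • y), curl (u (T + β * s)) (x₀ + γ • y)]) :
    κ * ‖curl ((a • stPull β γ T x₀ u) s) y‖ ^ 2 *
        Laplacian.laplacian ((a ^ 2 • stPull β γ T x₀ p) s) y ≤
      iteratedFDeriv ℝ 2 ((a ^ 2 • stPull β γ T x₀ p) s) y
        ![curl ((a • stPull β γ T x₀ u) s) y, curl ((a • stPull β γ T x₀ u) s) y] := by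
  set ω : EuclideanSpace ℝ (Fin 3) := curl (u (T + β * s)) (x₀ + γ • y) with hω
  have hcurl : curl ((a • stPull β γ T x₀ u) s) y = (a * γ) • ω :=
    curl_smul_stPull_slice hu y
  rw [hcurl, laplacian_smul_stPull_slice hp y, iteratedFDeriv_two_smul_stPull_slice hp y,
    iteratedFDeriv_two_apply]
  rw [iteratedFDeriv_two_apply] at hblob
  simp only [Matrix.cons_val_zero, Matrix.cons_val_one] at hblob ⊢
  simp only [map_smul, smul_apply, smul_eq_mul, norm_smul, Real.norm_eq_abs]
  set L : ℝ := Laplacian.laplacian (p (T + β * s)) (x₀ + γ • y) with hL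
  set F : ℝ := fderiv ℝ (fderiv ℝ (p (T + β * s))) (x₀ + γ • y) ω ω with hF
  have hsq : (|a * γ| * ‖ω‖) ^ 2 = (a * γ) ^ 2 * ‖ω‖ ^ 2 := by rw [mul_pow, sq_abs]
  have h0 : 0 ≤ a ^ 2 * γ ^ 2 := by positivity
  have key := mul_le_mul_of_nonneg_left hblob (mul_nonneg h0 (sq_nonneg (a * γ)))
  rw [hsq]
  calc κ * ((a * γ) ^ 2 * ‖ω‖ ^ 2) * (a ^ 2 * γ ^ 2 * L)
      = a ^ 2 * γ ^ 2 * (a * γ) ^ 2 * (κ * ‖ω‖ ^ 2 * L) := by ring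
    _ ≤ a ^ 2 * γ ^ 2 * (a * γ) ^ 2 * F := key
    _ = a ^ 2 * γ ^ 2 * (a * γ * (a * γ * F)) := by ring

/-! ### Registered sub-goal: the limit of a quadratic form under diagonal convergence -/

/-- Expansion of a bilinear form on `ℝ³` in the standard basis:
`H x y = Σᵢⱼ xᵢ yⱼ H(eᵢ, eⱼ)`. [folklore] -/
theorem bilin_apply_eq_sum
    (H : EuclideanSpace ℝ (Fin 3) →L[ℝ] EuclideanSpace ℝ (Fin 3) →L[ℝ] ℝ)
    (x y : EuclideanSpace ℝ (Fin 3)) :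
    H x y = ∑ i, ∑ j, x i * y j *
      H (EuclideanSpace.single i 1) (EuclideanSpace.single j 1) := by
  classical
  set b := EuclideanSpace.basisFun (Fin 3) ℝ with hb
  conv_lhs => rw [← b.sum_repr x, ← b.sum_repr y]
  simp only [map_sum, map_smul, sum_apply, smul_apply, smul_eq_mul, hb,
    EuclideanSpace.basisFun_repr, EuclideanSpace.basisFun_apply, Finset.mul_sum]
  rw [Finset.sum_comm]
  refine Finset.sum_congr rfl fun i _ => Finset.sum_congr rfl fun j _ => ?_
  ring

/-- Polarisation for a symmetric bilinear form: `4 H(a, b) = H(a+b, a+b) − H(a−b, a−b)`. [folklore] -/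
theorem bilin_polarisation
    (H : EuclideanSpace ℝ (Fin 3) →L[ℝ] EuclideanSpace ℝ (Fin 3) →L[ℝ] ℝ)
    (hH : ∀ v w, H v w = H w v) (a b : EuclideanSpace ℝ (Fin 3)) :
    H a b = (H (a + b) (a + b) - H (a - b) (a - b)) / 4 := by
  simp only [map_add, map_sub, add_apply, sub_apply]
  rw [hH b a]
  ring

/-- **Registered sub-goal `stub_hessianApplyLimit`** (line `type-i-apex-liouville`, tools of
stub B). If symmetric bilinear forms `H_j` on `ℝ³` converge to a symmetric form `H` on the
diagonal, `H_j(e, e) → H(e, e)` for every `e`, and `ω_j → ω`, then `H_j(ω_j, ω_j) → H(ω, ω)`.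
Proof: polarisation turns diagonal convergence into entrywise convergence `H_j(a, b) → H(a, b)`;
expand `ω_j` in the standard basis and pass to the limit in the finite sum. [folklore] -/
theorem stub_hessianApplyLimit :
    ∀ (H : ℕ → EuclideanSpace ℝ (Fin 3) →L[ℝ] EuclideanSpace ℝ (Fin 3) →L[ℝ] ℝ) (Hlim : EuclideanSpace ℝ (Fin 3) →L[ℝ] EuclideanSpace ℝ (Fin 3) →L[ℝ] ℝ) (ω : ℕ → EuclideanSpace ℝ (Fin 3)) (ωlim : EuclideanSpace ℝ (Fin 3)),
      (∀ j v w, H j v w = H j w v) → (∀ v w, Hlim v w = Hlim w v) →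
      (∀ e, Tendsto (fun j => H j e e) atTop (𝓝 (Hlim e e))) →
      Tendsto ω atTop (𝓝 ωlim) →
      Tendsto (fun j => H j (ω j) (ω j)) atTop (𝓝 (Hlim ωlim ωlim)) := by
  intro H Hlim ω ωlim hsym hsyml hdiag hω
  -- entrywise convergence by polarisation
  have hentry : ∀ a b, Tendsto (fun j => H j a b) atTop (𝓝 (Hlim a b)) := by
    intro a b
    have h := ((hdiag (a + b)).sub (hdiag (a - b))).div_const 4
    rw [← bilin_polarisation Hlim hsyml a b] at h
    exact h.congr fun j => (bilin_polarisation (H j) (hsym j) a b).symm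
  -- coordinates converge
  have hcoord : ∀ i, Tendsto (fun j => ω j i) atTop (𝓝 (ωlim i)) := fun i =>
    ((EuclideanSpace.proj i).continuous.tendsto ωlim).comp hω
  -- expand and pass to the limit
  have hlim : Tendsto (fun j => ∑ i, ∑ i', ω j i * ω j i' *
      H j (EuclideanSpace.single i 1) (EuclideanSpace.single i' 1)) atTop
      (𝓝 (∑ i, ∑ i', ωlim i * ωlim i' *
        Hlim (EuclideanSpace.single i 1) (EuclideanSpace.single i' 1))) :=
    tendsto_finsetSum _ fun i _ => tendsto_finsetSum _ fun i' _ =>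
      ((hcoord i).mul (hcoord i')).mul (hentry _ _)
  rw [bilin_apply_eq_sum Hlim]
  exact hlim.congr fun j => (bilin_apply_eq_sum (H j) (ω j) (ω j)).symm

/-- The Hessian of a `C²` function on `ℝ³` is a symmetric bilinear form. [folklore] -/
theorem hessian_symm {q : EuclideanSpace ℝ (Fin 3) → ℝ} (hq : ContDiff ℝ 2 q)
    (x v w : EuclideanSpace ℝ (Fin 3)) :
    fderiv ℝ (fderiv ℝ q) x v w = fderiv ℝ (fderiv ℝ q) x w v :=
  (hq.contDiffAt.isSymmSndFDerivAt (by simp)) v w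

end Summit.NavierStokesRegularity.NavierStokesRegularity.Theorems.BlobRiccatiClosure.TypeIApexLiouville

end
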